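import Summits.SmoothPoincare4.SmoothPoincare4.Theorems.SullivanDualTargetStubCroftonTaming
import Summits.SmoothPoincare4.SmoothPoincare4.Theorems.SullivanDualTargetCroftonPencilDefs
import Summits.SmoothPoincare4.SmoothPoincare4.Theorems.SullivanDualTargetOfWeakTame

/-!
# Reduction of crux `Target` along line `crofton-pencil-laminar-charge`
(item stmt-SmoothPoincare4-7823, route route-SmoothPoincare4-SullivanDual; skeleton v3
`Cruxes/Target/Lines/crofton_pencil_laminar_charge.lean`, lead a1)

With Stub 1 (`stub_croftonTaming`, the relative Crofton taming form as a parametric integral)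
PROVED (`Theorems/SullivanDualTargetStubCroftonTaming.lean`), the line's sorry-free composition
`Target_of` becomes the kernel-checked REDUCTION landed here:

  `Target ⟸ DualPlane' ∧ LinesOrCurve ∧ HyperbolicEnd`,

where the three hypotheses are spelled out verbatim (they are the registered stubs
`stub_dualPlane`, `stub_linesOrCurve` of the line and the route crux `HyperbolicEnd` =
`stub_hyperbolicEnd`, item 7825):
* DualPlane' — for `J` smooth, `J² = -1`, standard on a punctured chart-ball: bounded `J`-lines
  (`BoundedLines`) ⇒ intercept maps `Φ σ` with (Q1) joint smoothness, (Q2) positively oriented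
  `J`-complex transverse differential, (Q3) transverse pencils, (Q4) a charged member through
  every point (the compact dual plane of Gromov 1985 §2.4.A / McKay, read through intercepts);
* LinesOrCurve — unbounded `J`-lines ⇒ a non-constant entire `J`-curve avoiding a punctured
  chart-ball (`CurveAway`; Stokes confinement + Duval's Ahlfors currents);
* HyperbolicEnd — the route crux 7825.
Proof: pure logic over door (b) `SullivanDual.target_of_weakTame` (p123636) and
`stub_croftonTaming` (p128560): per `(Σ, p)` take `J, ε'` from HyperbolicEnd; bounded lines ⇒
intercept maps ⇒ closed taming form ⇒ the `WeakTame` datum; unbounded ⇒ an entire curve off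
`B_(min η (ε'/2))`, contradicting HyperbolicEnd.

This is the line's replacement of the route's `WitnessCharge` in `TargetOfCruxes`
(`WitnessCharge → HyperbolicEnd → Target`, landed `targetOfCruxes_proof`): the universally
quantified taming witnesses are traded for the energy dichotomy of the line pencil.
-/

noncomputable section

-- the prescribed namespace `Summit.<P>.<Sub>.…` duplicates `SmoothPoincare4` (P = Sub)
set_option linter.dupNamespace false

open scoped Manifold ContDiff Topology
open Set Filter MeasureTheory Literature.Geometry.Kaehler Literature.Geometry.Symplectic
  Literature.Topology.FourManifolds
open Summit.SmoothPoincare4.SmoothPoincare4.Theorems.WitnessCharge.PencilIncompleteness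

namespace Summit.SmoothPoincare4.SmoothPoincare4.Theorems.Target.CroftonPencil

/-- **Registered helper `helper_target_of_dualPlane_linesOrCurve`** — the line's reduction of the
crux: `DualPlane' → LinesOrCurve → HyperbolicEnd → Target` (hypotheses = the registered stubs
`stub_dualPlane`, `stub_linesOrCurve` verbatim and the route crux `HyperbolicEnd`; the Crofton
stub is the landed `stub_croftonTaming`). [cite: Gromov1985, §2.4.A–A′] -/
theorem helper_target_of_dualPlane_linesOrCurve :
    (∀ (S : HomotopySphere 4) (p : S.carrier)
      (J : ∀ x : punctured p, TangentSpace (𝓡 4) x →L[ℝ] TangentSpace (𝓡 4) x) (ε' : ℝ),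
      0 < ε' →
      Metric.closedBall (extChartAt (𝓡 4) p p) ε' ⊆ (extChartAt (𝓡 4) p).target →
      (∀ (x : punctured p) (v : TangentSpace (𝓡 4) x), J x (J x v) = -v) →
      (∀ x₀ : punctured p, ContMDiffAt (𝓡 4) 𝓘(ℝ, EuclideanSpace ℝ (Fin 4) →L[ℝ] EuclideanSpace ℝ (Fin 4)) ∞
        (inTangentCoordinates (𝓡 4) (𝓡 4) (id : punctured p → punctured p) id (fun x => J x) x₀) x₀) →
      (∀ x : punctured p, InPuncturedChartBall p ε' x →
        ∀ (v : TangentSpace (𝓡 4) x) (b : EuclideanSpace ℝ (Fin 4)),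
          inner ℝ (fderiv ℝ inversion (extChartAt (𝓡 4) p x.1 - extChartAt (𝓡 4) p p)
            (mfderiv (𝓡 4) 𝓘(ℝ, EuclideanSpace ℝ (Fin 4))
              (fun z : punctured p => extChartAt (𝓡 4) p z.1) x (J x v))) b
          = stdSymplecticForm (fderiv ℝ inversion (extChartAt (𝓡 4) p x.1 - extChartAt (𝓡 4) p p)
            (mfderiv (𝓡 4) 𝓘(ℝ, EuclideanSpace ℝ (Fin 4))
              (fun z : punctured p => extChartAt (𝓡 4) p z.1) x v)) b) →
      BoundedLines S p J →
      ∃ (Φ : Bool → ℂ → punctured p → ℂ) (R₀ : ℝ),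
        (∀ σ, ContMDiff (𝓘(ℝ, ℂ).prod (𝓡 4)) 𝓘(ℝ, ℂ) ∞ (Function.uncurry (Φ σ))) ∧
        (∀ σ (a : ℂ) (x : punctured p) (v : TangentSpace (𝓡 4) x),
          mfderiv (𝓡 4) 𝓘(ℝ, ℂ) (Φ σ a) x v ≠ 0 →
          0 < (mfderiv (𝓡 4) 𝓘(ℝ, ℂ) (Φ σ a) x v).re * (mfderiv (𝓡 4) 𝓘(ℝ, ℂ) (Φ σ a) x (J x v)).im
              - (mfderiv (𝓡 4) 𝓘(ℝ, ℂ) (Φ σ a) x v).im * (mfderiv (𝓡 4) 𝓘(ℝ, ℂ) (Φ σ a) x (J x v)).re) ∧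
        (∀ σ (x : punctured p) (v : TangentSpace (𝓡 4) x) (a a' : ℂ), v ≠ 0 →
          mfderiv (𝓡 4) 𝓘(ℝ, ℂ) (Φ σ a) x v = 0 → mfderiv (𝓡 4) 𝓘(ℝ, ℂ) (Φ σ a') x v = 0 → a = a') ∧
        (∀ x : punctured p, ∃ (σ : Bool) (a : ℂ), ‖a‖ ≤ 1 ∧ ‖Φ σ a x‖ ≤ R₀)) →
    (∀ (S : HomotopySphere 4) (p : S.carrier)
      (J : ∀ x : punctured p, TangentSpace (𝓡 4) x →L[ℝ] TangentSpace (𝓡 4) x) (ε' : ℝ),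
      0 < ε' →
      Metric.closedBall (extChartAt (𝓡 4) p p) ε' ⊆ (extChartAt (𝓡 4) p).target →
      (∀ (x : punctured p) (v : TangentSpace (𝓡 4) x), J x (J x v) = -v) →
      (∀ x₀ : punctured p, ContMDiffAt (𝓡 4) 𝓘(ℝ, EuclideanSpace ℝ (Fin 4) →L[ℝ] EuclideanSpace ℝ (Fin 4)) ∞
        (inTangentCoordinates (𝓡 4) (𝓡 4) (id : punctured p → punctured p) id (fun x => J x) x₀) x₀) →
      (∀ x : punctured p, InPuncturedChartBall p ε' x →
        ∀ (v : TangentSpace (𝓡 4) x) (b : EuclideanSpace ℝ (Fin 4)),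
          inner ℝ (fderiv ℝ inversion (extChartAt (𝓡 4) p x.1 - extChartAt (𝓡 4) p p)
            (mfderiv (𝓡 4) 𝓘(ℝ, EuclideanSpace ℝ (Fin 4))
              (fun z : punctured p => extChartAt (𝓡 4) p z.1) x (J x v))) b
          = stdSymplecticForm (fderiv ℝ inversion (extChartAt (𝓡 4) p x.1 - extChartAt (𝓡 4) p p)
            (mfderiv (𝓡 4) 𝓘(ℝ, EuclideanSpace ℝ (Fin 4))
              (fun z : punctured p => extChartAt (𝓡 4) p z.1) x v)) b) →
      ¬ BoundedLines S p J → CurveAway S p J) →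
    Summit.SmoothPoincare4.SmoothPoincare4.Theses.SullivanDual.HyperbolicEnd →
    Summit.SmoothPoincare4.SmoothPoincare4.Theses.SullivanDual.Target := by
  intro h2 h3 h4
  refine Summit.SmoothPoincare4.SmoothPoincare4.Theorems.SullivanDual.target_of_weakTame
    (fun S p => ?_)
  obtain ⟨J, ε', hε', hball, hJ2, hJs, hstd, hno⟩ := h4 S p
  rcases Classical.em (BoundedLines S p J) with hB | hB
  · obtain ⟨Φ, R₀, hΦ1, hΦ2, hΦ3, hΦ4⟩ := h2 S p J ε' hε' hball hJ2 hJs hstd hB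
    obtain ⟨sf, hsf, hsfc, htame⟩ := stub_croftonTaming S p J Φ R₀ hΦ1 hΦ2 hΦ3 hΦ4
    exact ⟨J, ε', hε', hball, hJ2, hJs, hstd, sf, hsf, hsfc, htame⟩
  · exfalso
    obtain ⟨u, hu, η, hη, hav⟩ := h3 S p J ε' hε' hball hJ2 hJs hstd hB
    have hlt : min η (ε' / 2) < ε' := lt_of_le_of_lt (min_le_right _ _) (half_lt_self hε')
    refine hno (min η (ε' / 2)) (lt_min hη (half_pos hε')) hlt
      ⟨u, hu.1, hu.2.1, hu.2.2, fun z hz => hav z ?_⟩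
    exact ⟨hz.1, Metric.ball_subset_ball (min_le_left _ _) hz.2⟩

end Summit.SmoothPoincare4.SmoothPoincare4.Theorems.Target.CroftonPencil

end
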